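import Literature.Analysis.FluidPDE.Ferrari1993H3Bound
import Literature.Analysis.FluidPDE.KatoLaiUniformExistenceBridge
import HarnessLib

/-!
# `Ferrari1993_periodicCylinderH3Bound` on two analytic facts: discharge of the time-regularity
input of the Gronwall step

Topic `Literature/Analysis/FluidPDE`. Second file of the decomposition of
`Literature.Analysis.FluidPDE.Ferrari1993_periodicCylinderH3Bound` (`Ferrari1993H3Bound.lean`,
Ferrari 1993, proof of Thm 2, (4) ⇒ (7)). That file proves the target from the `H^s` energy
inequality `Ferrari1993_periodicCylinderHsEnergyInequality` (Ferrari (13)–(14)), the logarithmic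
estimate `ShirotaYanagisawa1993_periodicCylinderLogEstimate` (Shirota–Yanagisawa (15), (17);
Ferrari (31)) and the time-regularity proposition
`smoothPeriodicCylinderClass_locallyBoundedH3Norm` (the smooth class has
`sup_{[0,b]} ‖u(t)‖_{H³(cell)} < ∞` for `b < T` — Ferrari's class `C([0,T]; H^s(Ω))`,
Shirota–Yanagisawa's `X_s(T')`, as far as boundedness goes). Here the
proposition is **discharged** (`smoothPeriodicCylinderClass_locallyBoundedH3Norm_holds`), leaving
`Ferrari1993_periodicCylinderH3Bound_of_energyInequality_of_logEstimate :
(13)–(14) → (15)/(31) → target`.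

The discharge is the time-uniform version of
`eSobolevDomainNorm_cylinderCell_lt_top` / `eSobolevDomainNorm_lt_top_of_contDiffOn`
(`KatoLaiUniformExistenceBridge.lean`: a field `C^∞` on the closed cylinder has finite Sobolev
norms of every order on the period cell), for a field `w` which is `C^∞` jointly in `(t, x)` on
`S × {r ≤ 1}`, `S ⊇ [0, b]` of unique differentiability
(`exists_forall_eSobolevDomainNorm_slice_le`): by induction on `k`, the infimum in the
tree's norm `‖f‖_{W^{k+1,p}} = ‖f‖_{L^p} + inf_g Σᵢ ‖g eᵢ‖_{W^{k,p}}` is attained at the classical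
derivative of the slice (`MeyersSerrin.eSobolevDomainNorm_succ_eq`,
`MeyersSerrin.hasWeakFDerivOn_of_contDiffOn`), whose components agree on the open cylinder with
the spatial components `∂ᵥw (t, x) = D(t, x)(0, v)` of the *joint* derivative
`D = fderivWithin (uncurry w) (S × {r ≤ 1})`
(`SpaceTimeSliceCalculus.fderiv_slice_of_contDiffOn`), again jointly `C^∞`, so that the induction
hypothesis applies to them; the `L^p` norms are bounded by `sup ‖w‖` on the compact
`[0, b] × closure (cell)` times `vol(cell)^{1/p}`. All statements are folklore calculus.
-/

noncomputable section

open MeasureTheory Set Function Filter Topology TopologicalSpace WithLp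
open scoped ContDiff NNReal ENNReal InnerProductSpace RealInnerProductSpace

namespace Literature.Analysis.FluidPDE

open Literature.Analysis.FunctionSpaces

section Slices

variable {F : Type*} [NormedAddCommGroup F] [NormedSpace ℝ F]

omit [NormedSpace ℝ F] in
/-- **Uniform sup bound on compact time intervals.** A field continuous on `S × closure {r < 1}`,
`S ⊇ [0, b]`, is bounded on `[0, b] × cell` (continuity on the compact
`[0, b] × closure (cell)`). [folklore] -/
theorem exists_forall_norm_slice_le {S : Set ℝ} {w : ℝ → EuclideanSpace ℝ (Fin 3) → F}
    (hw : ContinuousOn (uncurry w)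
      (S ×ˢ closure (unitCylinder : Set (EuclideanSpace ℝ (Fin 3))))) {b : ℝ}
    (hb : Icc (0 : ℝ) b ⊆ S) (L : ℝ) :
    ∃ C : ℝ, 0 ≤ C ∧ ∀ t ∈ Icc (0 : ℝ) b,
      ∀ x ∈ (cylinderCell L : Set (EuclideanSpace ℝ (Fin 3))), ‖w t x‖ ≤ C := by
  have hc : IsCompact
      (Icc (0 : ℝ) b ×ˢ closure (cylinderCell L : Set (EuclideanSpace ℝ (Fin 3)))) :=
    isCompact_Icc.prod (isCompact_closure_cylinderCell L)
  obtain ⟨C, hC⟩ := hc.exists_bound_of_continuousOn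
    (hw.mono (prod_mono hb (closure_cylinderCell_subset L)))
  refine ⟨max C 0, le_max_right _ _, fun t ht x hx => ?_⟩
  exact (hC (t, x) ⟨ht, subset_closure hx⟩).trans (le_max_left _ _)

omit [NormedSpace ℝ F] in
/-- **Uniform `L^p` bound on compact time intervals** for the slices on the period cell:
`‖w(t)‖_{L^p(cell)} ≤ vol(cell)^{1/p} sup_{[0,b] × cell} ‖w‖`. [folklore] -/
theorem exists_forall_eLpNorm_slice_le {S : Set ℝ} {w : ℝ → EuclideanSpace ℝ (Fin 3) → F}
    (hw : ContinuousOn (uncurry w)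
      (S ×ˢ closure (unitCylinder : Set (EuclideanSpace ℝ (Fin 3))))) {b : ℝ}
    (hb : Icc (0 : ℝ) b ⊆ S) (L : ℝ) (p : ℝ≥0∞) :
    ∃ M : ℝ≥0, ∀ t ∈ Icc (0 : ℝ) b,
      eLpNorm (w t) p
        (volume.restrict (cylinderCell L : Set (EuclideanSpace ℝ (Fin 3)))) ≤ M := by
  obtain ⟨C, hC0, hC⟩ := exists_forall_norm_slice_le hw hb L
  set Ω : Set (EuclideanSpace ℝ (Fin 3)) := (cylinderCell L : Set (EuclideanSpace ℝ (Fin 3)))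
    with hΩ
  have hfin : volume Ω < ⊤ :=
    (measure_mono subset_closure).trans_lt (isCompact_closure_cylinderCell L).measure_lt_top
  set M : ℝ≥0∞ := volume Ω ^ p.toReal⁻¹ * ENNReal.ofReal C with hM
  have hMfin : M ≠ ⊤ :=
    ENNReal.mul_ne_top (ENNReal.rpow_ne_top_of_nonneg (by positivity) hfin.ne)
      ENNReal.ofReal_ne_top
  refine ⟨M.toNNReal, fun t ht => ?_⟩
  rw [ENNReal.coe_toNNReal hMfin]
  have hae : ∀ᵐ x ∂(volume.restrict Ω), ‖w t x‖ ≤ C :=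
    (ae_restrict_iff' (cylinderCell L).isOpen.measurableSet).2
      (Eventually.of_forall fun x hx => hC t ht x hx)
  refine (eLpNorm_le_of_ae_bound hae).trans ?_
  rw [Measure.restrict_apply_univ]

/-- The spatial components `∂ᵥw (t, x) = D(t, x)(0, v)` of the joint derivative within
`S × closure {r < 1}` of a jointly `C^∞` field are jointly `C^∞` there. [folklore] -/
theorem contDiffOn_uncurry_fderivWithin_apply {S : Set ℝ} (hS : UniqueDiffOn ℝ S)
    {w : ℝ → EuclideanSpace ℝ (Fin 3) → F}
    (hw : ContDiffOn ℝ ∞ (uncurry w)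
      (S ×ˢ closure (unitCylinder : Set (EuclideanSpace ℝ (Fin 3)))))
    (v : EuclideanSpace ℝ (Fin 3)) :
    ContDiffOn ℝ ∞
      (uncurry fun t x => fderivWithin ℝ (uncurry w)
        (S ×ˢ closure (unitCylinder : Set (EuclideanSpace ℝ (Fin 3)))) (t, x) ((0 : ℝ), v))
      (S ×ˢ closure (unitCylinder : Set (EuclideanSpace ℝ (Fin 3)))) := by
  set P : Set (ℝ × EuclideanSpace ℝ (Fin 3)) :=
    S ×ˢ closure (unitCylinder : Set (EuclideanSpace ℝ (Fin 3))) with hP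
  have hD : ContDiffOn ℝ ∞ (fun z => fderivWithin ℝ (uncurry w) P z) P :=
    hw.fderivWithin (hS.prod uniqueDiffOn_closure_unitCylinder) (by simp)
  have h := hD.clm_apply contDiffOn_const (g := fun _ => ((0 : ℝ), v))
  refine h.congr ?_
  rintro ⟨t, x⟩ _
  rfl

/-- On the open cylinder the spatial components of the joint derivative are the classical
derivatives of the slice: `D(w t)(x) v = D(t, x)(0, v)` for `r(x) < 1`. [folklore] -/
theorem fderiv_slice_apply_eq {S : Set ℝ} {w : ℝ → EuclideanSpace ℝ (Fin 3) → F}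
    {n : WithTop ℕ∞}
    (hw : ContDiffOn ℝ n (uncurry w)
      (S ×ˢ closure (unitCylinder : Set (EuclideanSpace ℝ (Fin 3))))) (hn : n ≠ 0)
    {t : ℝ} (ht : t ∈ S) {x : EuclideanSpace ℝ (Fin 3)} (hx : x ∈ unitCylinder)
    (v : EuclideanSpace ℝ (Fin 3)) :
    fderiv ℝ (w t) x v = fderivWithin ℝ (uncurry w)
      (S ×ˢ closure (unitCylinder : Set (EuclideanSpace ℝ (Fin 3)))) (t, x) ((0 : ℝ), v) := by
  rw [fderiv_slice_of_contDiffOn hw hn ht (subset_closure hx) (closure_unitCylinder_mem_nhds hx)]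
  rfl

variable [CompleteSpace F]

/-- **Time-uniform Sobolev bounds for slices of jointly smooth fields.** If `w` is `C^∞` jointly
in `(t, x)` on `S × {r ≤ 1}` with `S ⊇ [0, b]` of unique differentiability, then for all `k`,
`p`, `L` the norms `‖w(t)‖_{W^{k,p}(cell)}` (the tree's
`eSobolevDomainNorm k p (cylinderCell L)`) are bounded uniformly in `t ∈ [0, b]`: by induction on
`k`, the infimum in the norm being attained at the classical derivative of the slice
(`MeyersSerrin.eSobolevDomainNorm_succ_eq`, `MeyersSerrin.hasWeakFDerivOn_of_contDiffOn`), whose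
components are, on the cell, the slices of the jointly smooth fields `∂ᵥw`
(`fderiv_slice_apply_eq`, `contDiffOn_uncurry_fderivWithin_apply`) to which the induction
hypothesis applies, and the `L^p` norms being bounded on `[0, b]`
(`exists_forall_eLpNorm_slice_le`); the time-uniform form of
`eSobolevDomainNorm_lt_top_of_contDiffOn`. [folklore] -/
theorem exists_forall_eSobolevDomainNorm_slice_le (k : ℕ) (p : ℝ≥0∞) (L : ℝ) {S : Set ℝ}
    (hS : UniqueDiffOn ℝ S) {b : ℝ} (hb : Icc (0 : ℝ) b ⊆ S)
    {w : ℝ → EuclideanSpace ℝ (Fin 3) → F}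
    (hw : ContDiffOn ℝ ∞ (uncurry w)
      (S ×ˢ closure (unitCylinder : Set (EuclideanSpace ℝ (Fin 3))))) :
    ∃ M : ℝ≥0, ∀ t ∈ Icc (0 : ℝ) b,
      eSobolevDomainNorm k p (cylinderCell L) volume (w t) ≤ M := by
  induction k generalizing w with
  | zero =>
    obtain ⟨M, hM⟩ := exists_forall_eLpNorm_slice_le hw.continuousOn hb L p
    exact ⟨M, fun t ht => by rw [eSobolevDomainNorm_zero]; exact hM t ht⟩
  | succ k ih =>
    set K : Set (EuclideanSpace ℝ (Fin 3)) :=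
      closure (unitCylinder : Set (EuclideanSpace ℝ (Fin 3))) with hK
    -- the spatial components of the joint derivative, as fields
    set W : EuclideanSpace ℝ (Fin 3) → ℝ → EuclideanSpace ℝ (Fin 3) → F := fun v t x =>
      fderivWithin ℝ (uncurry w) (S ×ˢ K) (t, x) ((0 : ℝ), v) with hW
    have hWs : ∀ v, ContDiffOn ℝ ∞ (uncurry (W v)) (S ×ˢ K) := fun v =>
      contDiffOn_uncurry_fderivWithin_apply hS hw v
    -- induction hypothesis for each basis component, and the `L^p` bound
    set e := Module.finBasis ℝ (EuclideanSpace ℝ (Fin 3)) with he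
    choose Mi hMi using fun i => ih (hWs (e i))
    obtain ⟨M₀, hM₀⟩ := exists_forall_eLpNorm_slice_le hw.continuousOn hb L p
    refine ⟨M₀ + ∑ i, Mi i, fun t ht => ?_⟩
    have htS : t ∈ S := hb ht
    -- the slice is smooth on the cell, so the infimum is attained at its classical derivative
    have hslice : ContDiffOn ℝ ∞ (w t) (cylinderCell L : Set (EuclideanSpace ℝ (Fin 3))) :=
      (contDiffOn_slice_of_contDiffOn_uncurry hw htS).mono
        (fun x hx => subset_closure (cylinderCell_le_unitCylinder L hx))
    rw [MeyersSerrin.eSobolevDomainNorm_succ_eq (p := p) (k := k)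
      (MeyersSerrin.hasWeakFDerivOn_of_contDiffOn (μ := volume) hslice)]
    -- whose components are the slices of the fields `W (e i)` on the cell
    have hae : ∀ i, (fun x => fderiv ℝ (w t) x (e i))
        =ᵐ[volume.restrict (cylinderCell L : Set (EuclideanSpace ℝ (Fin 3)))] W (e i) t :=
      fun i => ae_restrict_of_forall_mem (cylinderCell L).isOpen.measurableSet fun x hx =>
        fderiv_slice_apply_eq hw (by simp) htS (cylinderCell_le_unitCylinder L hx) (e i)
    push_cast
    gcongr with i _
    · exact hM₀ t ht
    · rw [MeyersSerrin.eSobolevDomainNorm_congr_ae (hae i)]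
      exact hMi i t ht

/-- **Time-local boundedness of the Sobolev norms in the smooth periodic class**: for a solution
of the class `IsPeriodicCylinderEulerSolution L [0, T) u₀` and `b < T`, the norms
`‖u(t)‖_{W^{k,p}(cell)}` are bounded uniformly in `t ∈ [0, b]`, for all `k` and `p`.
[folklore] -/
theorem IsPeriodicCylinderEulerSolution.exists_forall_eSobolevDomainNorm_le {L : ℝ} {T : ℝ}
    {u₀ : EuclideanSpace ℝ (Fin 3) → EuclideanSpace ℝ (Fin 3)}
    {u : ℝ → EuclideanSpace ℝ (Fin 3) → EuclideanSpace ℝ (Fin 3)}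
    {p : ℝ → EuclideanSpace ℝ (Fin 3) → ℝ}
    (h : IsPeriodicCylinderEulerSolution L (Ico 0 T) u₀ u p) (k : ℕ) (q : ℝ≥0∞) {b : ℝ}
    (hb : b < T) :
    ∃ M : ℝ≥0, ∀ t ∈ Icc (0 : ℝ) b,
      eSobolevDomainNorm k q (cylinderCell L) volume (u t) ≤ M :=
  exists_forall_eSobolevDomainNorm_slice_le k q L (uniqueDiffOn_Ico 0 T)
    (fun _ ht => ⟨ht.1, ht.2.trans_lt hb⟩) h.smooth_velocity

end Slices

/-! ### Discharge of the time-regularity proposition, and the target on two facts -/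

/-- **Discharge of `smoothPeriodicCylinderClass_locallyBoundedH3Norm`**: the smooth periodic
class has time-locally bounded `H³(cell)` norms
(`IsPeriodicCylinderEulerSolution.exists_forall_eSobolevDomainNorm_le` with `k = 3`, `p = 2`).
[folklore] -/
theorem smoothPeriodicCylinderClass_locallyBoundedH3Norm_holds :
    smoothPeriodicCylinderClass_locallyBoundedH3Norm :=
  fun _L _u₀ _T _u _p hsol _b hb => hsol.exists_forall_eSobolevDomainNorm_le 3 2 hb

/-- **`Ferrari1993_periodicCylinderH3Bound` from the `H^s` energy inequality and the logarithmic
estimate** (Ferrari 1993, proof of Thm 2, (13)–(17) pp. 280–282; Shirota–Yanagisawa 1993,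
(14)–(17) p. 80): `Ferrari1993_periodicCylinderH3Bound_of_estimates` with its time-regularity
input discharged. The a-priori bound, and with it the continuation / BKM chain of
`KatoLaiUniformExistenceBridge.lean`, thus rests on the two analytic named facts
`Ferrari1993_periodicCylinderHsEnergyInequality` and
`ShirotaYanagisawa1993_periodicCylinderLogEstimate` (plus Kato–Lai's uniform-time existence).
[cite: Ferrari1993, proof of Thm 2, (13)–(17) pp. 280–282] -/
theorem Ferrari1993_periodicCylinderH3Bound_of_energyInequality_of_logEstimate
    (hA : Ferrari1993_periodicCylinderHsEnergyInequality)
    (hB : ShirotaYanagisawa1993_periodicCylinderLogEstimate) :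
    Ferrari1993_periodicCylinderH3Bound :=
  Ferrari1993_periodicCylinderH3Bound_of_estimates hA hB
    smoothPeriodicCylinderClass_locallyBoundedH3Norm_holds

end Literature.Analysis.FluidPDE
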